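import Literature.Analysis.FluidPDE.SereginSverakBlowupRepresentative
import Literature.Analysis.FluidPDE.SereginSverakBlowupLimit
import Literature.Analysis.FluidPDE.SereginSverakBlowupProofs
import HarnessLib

/-!
# Seregin–Šverák 2009, §4: the compactness of the blow-up sequence, from the local Hölder bound

G. Seregin, V. Šverák, *On Type I singularities of the local axi-symmetric solutions of the
Navier–Stokes equations*, Comm. PDE 34 (2009) 171–201 = arXiv:0804.1803, §4 (arXiv p. 11;
reprinted in G. Seregin, *Lecture notes on regularity theory for the Navier–Stokes equations*
(2014), §6.5, p. 125). Companion of `SereginSverakBlowup`, which vendors step (iv) of §4 as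
the named fact `SereginSverak2009.BlowupCompactness` and the one regularity estimate inside it
as the named fact `SereginSverak2009.LocalHolderBound` ("sequence `u^k` is uniformly bounded in
the parabolic Hölder space `C^{1/2}(Q̄(a/2))`", from [LSU] and the local regularity theory of
the Stokes system [S8]).

This file PROVES the rest of step (iv) as printed:

> Hence, without loss of generality, one may assume that `u^k → u` in `C^{1/4}(Q̄(a/2))`. This
> means that the pair `u` and `p` obeys the Navier–Stokes system and (p11) `|u(y'_*,0,0)| = 1`
> holds. So, the function `u` is the so-called bounded ancient solution to the Navier–Stokes
> system which is, in addition, axially symmetric and satisfies the decay estimate (p10).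

namely `SereginSverak2009.blowupCompactness_of_localHolderBound :
LocalHolderBound → BlowupCompactness`. With it, the discharge `BlowupCompactness_holds` is
reduced to `LocalHolderBound_holds` (parabolic `L_p` theory: [LSU], [S8], the parabolic
embedding theorem), which is not in Mathlib or in the tree and is not attempted here; and,
combined with the sibling reduction `blowupAlternativeTypeI_of_facts`
(`SereginSverakBlowupProofs`), the blow-up alternative and Theorem 3.1 are recorded conditionally
on `InteriorContinuity` and `LocalHolderBound` in place of `BlowupCompactness`
(`blowupAlternativeTypeI_of_localHolderBound`, `isRegularAtOrigin_of_typeI_of_localHolderBound`).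

## The proof

Let `V_k` be the continuous representatives of the hypotheses of `BlowupCompactness`
(continuous on `𝒞(R_k) × ]-R_k², 0]`, `V_k = u^k` a.e. on `Q(R_k)`, `m ≤ |V_k(0, y_k)|`), and
`T_n = [-(n+1)², 0] × {|y'| ≤ n+1, |y₃| ≤ n+1}` the compact cylinders-with-top exhausting the
closed half-space `{s ≤ 0} × ℝ³`.
1. (`SereginSverakBlowupRepresentative`) For all large `k`: `|V_k| ≤ 1`, `|y'||V_k| ≤ A₂` and
   `V_k(s, R_θ y) = R_θ V_k(s, y)` at every point of `𝒞(R_k) × ]-R_k², 0]`; and, applying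
   `LocalHolderBound` on `Q(4a)`, `a = 2(n+2)` (the pressure bound of the hypotheses at radius
   `4a`, `R_k ≥ 4a`), the Hölder representative on `Q(a/2) = Q(n+2)` coincides with `V_k`
   there, so `V_k` has a Hölder modulus on `T_n`, uniformly in `k`.
2. (`SereginSverakBlowupExtraction`) Arzelà–Ascoli on each `T_n` and a diagonal subsequence:
   `V_{φ(j)} → W` uniformly on every `T_n`.
3. `W` is continuous on `{s ≤ 0} × ℝ³`, `|W| ≤ 1`, `|y'||W| ≤ A₂`, `W(s, R_θ y) = R_θ W(s, y)`
   (pointwise limits), and `|W(0, y_*)| ≥ m` (uniform convergence on a `T_n` containing the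
   `(0, y_{φ(j)})`, and `y_{φ(j)} → y_*`) — the printed (p8), (p10), axial symmetry and (p11).
4. (`SereginSverakBlowupLimit`) Every divergence-free space–time test field `ψ` on the slab
   `]-∞, 0[ × ℝ³` is supported in some `Q(N+1) ⊆ T_N ⊆ Q(R_{φ(j)})`; the distributional identity
   of `(u^{φ(j)}, p^{φ(j)})` tested with `ψ` has no pressure term and passes to the limit by
   dominated convergence; Fubini puts it in the iterated form of KNSS's bounded weak solutions.
   The divergence identity passes to the limit likewise and yields weakly divergence-free
   slices for a.e. `t < 0`. Hence `w(t, x) = W(t, x)` is a bounded weak solution on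
   `ℝ³ × ]-∞, 0[` (accepted `IsBoundedWeakNSSolutionOn (Iio 0)`), axisymmetric and decaying in
   the a.e. forms, and it is not a.e. zero: by continuity of `W` up to `s = 0` at `(0, y_*)`,
   `|W| > m/2` on `]-δ, 0] × B(y_*, δ)`, a set every time slice of which has positive measure.

## References

* G. Seregin, V. Šverák, Comm. PDE 34 (2009), arXiv:0804.1803, §4 p. 11, (p5)–(p12).
  [`SereginSverak2009`]
* G. Seregin, *Lecture notes on regularity theory for the Navier–Stokes equations*, World
  Scientific (2014), §6.5 p. 125. [`Seregin2014`]
* G. Koch, N. Nadirashvili, G. Seregin, V. Šverák, Acta Math. 203 (2009), §4 (ii).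
  [`KochNadirashviliSereginSverak2009`]
-/

noncomputable section

open MeasureTheory Set Function Filter Topology TopologicalSpace Metric
open scoped Laplacian InnerProductSpace RealInnerProductSpace NNReal ENNReal

namespace Literature.Analysis.FluidPDE

namespace SereginSverak2009

/-- **Seregin–Šverák 2009, §4, step (iv): the compactness of the blow-up sequence, given the
uniform local Hölder bound.** `LocalHolderBound → BlowupCompactness`: from the printed estimate
"sequence `u^k` is uniformly bounded in the parabolic Hölder space `C^{1/2}(Q̄(a/2))`" (for every
`a`, vendored as `LocalHolderBound`) one extracts `u^k → u` locally uniformly on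
`ℝ³ × ]-∞, 0]` (Arzelà–Ascoli and a diagonal subsequence), and the limit is a bounded weak
solution of Navier–Stokes on `ℝ³ × ]-∞, 0[` in the class of KNSS 2009 (= Def. 2.3 of the
paper), axially symmetric, with `|y'||u| ≤ A₂` ((p10)) and `|u(y'_*, 0, 0)| ≥ m > 0` ((p11)), in
particular not a.e. zero. See the module docstring for the proof.
[cite: SereginSverak2009, §4 (p5)–(p11) and the paragraph following (p12) (arXiv p. 11); Seregin2014 §6.5 p. 125] -/
theorem blowupCompactness_of_localHolderBound (hLHB : LocalHolderBound) : BlowupCompactness := by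
  intro U P R y yStar A₂ m hR hy hm hNS hb haxi hdec hpress hV
  choose V hVc hVU hyR hmV using hV
  -- the compact cylinders-with-top `T n = [-(n+1)², 0] × {|y'| ≤ n+1, |y₃| ≤ n+1}`
  set T : ℕ → Set (ℝ × EuclideanSpace ℝ (Fin 3)) := fun n => Icc (-((n : ℝ) + 1) ^ 2) 0 ×ˢ
    {x : EuclideanSpace ℝ (Fin 3) | cylRadius x ≤ (n : ℝ) + 1 ∧ |x 2| ≤ (n : ℝ) + 1} with hT
  have hTc : ∀ n, IsCompact (T n) := fun n => isCompact_closedTop ((n : ℝ) + 1)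
  /- Step 1: for each `n`, eventually in `k`: continuity, the bound `1` and a common Hölder
  modulus on `T n` (from `LocalHolderBound` on `Q(4a)`, `a = 2 (n + 2)`). -/
  have hstep1 : ∀ n : ℕ, ∃ K α : ℝ, 0 ≤ K ∧ 0 < α ∧ ∀ᶠ k in atTop,
      ContinuousOn (V k) (T n) ∧ (∀ z ∈ T n, ‖V k z‖ ≤ 1) ∧
      ∀ z ∈ T n, ∀ z' ∈ T n, dist (V k z) (V k z') ≤ K * dist z z' ^ α := by
    intro n
    have hρ0 : (0 : ℝ) ≤ (n : ℝ) + 1 := by positivity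
    set a : ℝ := 2 * ((n : ℝ) + 2) with ha
    have ha0 : 0 < a := by positivity
    have h4a0 : (0 : ℝ) ≤ 4 * a := by positivity
    obtain ⟨c, hc⟩ := hpress (4 * a) (by positivity)
    obtain ⟨α, K, hα, hfact⟩ := hLHB a ha0 c
    refine ⟨K, α, K.coe_nonneg, NNReal.coe_pos.2 hα, ?_⟩
    filter_upwards [hR.eventually_ge_atTop (4 * a), hc] with k hk hck
    have hρR : (n : ℝ) + 1 < R k := by linarith
    have haR : a / 2 ≤ R k := by linarith
    have hTk : T n ⊆ parCylTop (R k) := closedTop_subset_parCylTop hρ0 hρR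
    refine ⟨(hVc k).mono hTk, fun z hz => norm_repr_le (hVc k) (hVU k) (hb k) z (hTk hz), ?_⟩
    have hle : parCylOpens 0 (4 * a) ≤ parCylOpens 0 (R k) := fun z hz => parCyl_mono 0 h4a0 hk hz
    have hb' : ∀ᵐ z ∂(volume.restrict (parCyl 0 (4 * a))), ‖U k z.1 z.2‖ ≤ 1 :=
      ae_restrict_of_ae_restrict_of_subset (parCyl_mono 0 h4a0 hk) (hb k)
    obtain ⟨V', hV'U, hH⟩ := hfact (U k) (P k) ((hNS k).of_le hle) hb' hck
    have hVUa : V k =ᵐ[volume.restrict (parCyl 0 (a / 2))] uncurry (U k) :=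
      ae_restrict_of_ae_restrict_of_subset (parCyl_mono 0 (by positivity) haR) (hVU k)
    exact dist_repr_le_of_holderOnWith (hVc k) haR hVUa hV'U hα hH hρ0 (by linarith)
  /- Step 2: the diagonal Arzelà–Ascoli extraction. -/
  choose K α hK hα hev using hstep1
  obtain ⟨φ, hφ, W, hW⟩ := exists_strictMono_tendstoUniformlyOn hTc hK hα hev
  /- Step 3: properties of the limit `W` on the closed half-space `{s ≤ 0} × ℝ³`. -/
  have hTmem : ∀ z : ℝ × EuclideanSpace ℝ (Fin 3), z.1 ≤ 0 →
      ∃ n, z ∈ T n ∧ T n ∈ 𝓝[Iic 0 ×ˢ univ] z := by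
    intro z hz
    obtain ⟨n, h1, h2, h3⟩ := exists_nat_lt_closedTop z
    exact ⟨n, ⟨⟨h1.le, hz⟩, h2.le, h3.le⟩, closedTop_mem_nhdsWithin h1 h2 h3⟩
  have hevφ : ∀ n, ∀ᶠ j in atTop, ContinuousOn (V (φ j)) (T n) ∧
      (∀ z ∈ T n, ‖V (φ j) z‖ ≤ 1) ∧
      ∀ z ∈ T n, ∀ z' ∈ T n, dist (V (φ j) z) (V (φ j) z') ≤ K n * dist z z' ^ α n :=
    fun n => hφ.tendsto_atTop.eventually (hev n)
  have hTR : ∀ n, ∀ᶠ j in atTop, T n ⊆ parCylTop (R (φ j)) := fun n => by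
    filter_upwards [hφ.tendsto_atTop.eventually (hR.eventually_gt_atTop ((n : ℝ) + 1))]
      with j hj
    exact closedTop_subset_parCylTop (by positivity) hj
  have hWcT : ∀ n, ContinuousOn W (T n) := fun n =>
    (hW n).continuousOn ((hevφ n).mono fun j hj => hj.1).frequently
  have hWc : ContinuousOn W (Iic 0 ×ˢ univ) := by
    intro z hz
    obtain ⟨n, hzn, hn⟩ := hTmem z hz.1
    exact (hWcT n z hzn).mono_of_mem_nhdsWithin hn
  have hWc' : ContinuousOn W (Iio 0 ×ˢ univ) := hWc.mono (prod_mono Iio_subset_Iic_self Subset.rfl)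
  have hpt : ∀ n, ∀ z ∈ T n, Tendsto (fun j => V (φ j) z) atTop (𝓝 (W z)) := fun n z hz =>
    (hW n).tendsto_at hz
  -- (p8): `|W| ≤ 1`
  have hWb : ∀ z : ℝ × EuclideanSpace ℝ (Fin 3), z.1 ≤ 0 → ‖W z‖ ≤ 1 := by
    intro z hz
    obtain ⟨n, hzn, -⟩ := hTmem z hz
    exact le_of_tendsto (hpt n z hzn).norm ((hevφ n).mono fun j hj => hj.2.1 z hzn)
  -- (p10): `|y'| |W| ≤ A₂`
  have hWdec : ∀ z : ℝ × EuclideanSpace ℝ (Fin 3), z.1 ≤ 0 → cylRadius z.2 * ‖W z‖ ≤ A₂ := by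
    intro z hz
    obtain ⟨n, hzn, -⟩ := hTmem z hz
    have hlim : Tendsto (fun j => cylRadius z.2 * ‖V (φ j) z‖) atTop
        (𝓝 (cylRadius z.2 * ‖W z‖)) := (hpt n z hzn).norm.const_mul _
    refine le_of_tendsto hlim ?_
    filter_upwards [hTR n] with j hj
    exact cylRadius_mul_norm_repr_le (hVc (φ j)) (hVU (φ j)) (hdec (φ j)) z (hj hzn)
  -- axial symmetry
  have hWrot : ∀ θ : ℝ, ∀ z : ℝ × EuclideanSpace ℝ (Fin 3), z.1 ≤ 0 →
      W (z.1, rotZ θ z.2) = rotZ θ (W z) := by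
    intro θ z hz
    obtain ⟨n, hzn, -⟩ := hTmem z hz
    have hzn' : (z.1, rotZ θ z.2) ∈ T n := by
      refine ⟨hzn.1, ?_, ?_⟩
      · simpa only [cylRadius_rotZ] using hzn.2.1
      · simpa only [rotZ_apply_two] using hzn.2.2
    have h1 : Tendsto (fun j => V (φ j) (z.1, rotZ θ z.2)) atTop (𝓝 (W (z.1, rotZ θ z.2))) :=
      hpt n _ hzn'
    have h2 : Tendsto (fun j => rotZ θ (V (φ j) z)) atTop (𝓝 (rotZ θ (W z))) :=
      ((rotZLIE θ).continuous.tendsto _).comp (hpt n z hzn)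
    refine tendsto_nhds_unique (h1.congr' ?_) h2
    filter_upwards [hTR n] with j hj
    exact repr_rotZ (hVc (φ j)) (hVU (φ j)) (haxi (φ j)) θ z (hj hzn)
  -- (p11): `m ≤ |W(0, y_*)|`
  have hm' : m ≤ ‖W ((0 : ℝ), yStar)‖ := by
    obtain ⟨n, -, hn⟩ := hTmem ((0 : ℝ), yStar) le_rfl
    have hmemj : ∀ j, (((0 : ℝ), y (φ j)) : ℝ × EuclideanSpace ℝ (Fin 3)) ∈
        Iic (0 : ℝ) ×ˢ (univ : Set (EuclideanSpace ℝ (Fin 3))) :=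
      fun j => mk_mem_prod self_mem_Iic (mem_univ _)
    have hyφ : Tendsto (fun j => (((0 : ℝ), y (φ j)) : ℝ × EuclideanSpace ℝ (Fin 3))) atTop
        (𝓝[Iic 0 ×ˢ univ] ((0 : ℝ), yStar)) :=
      tendsto_nhdsWithin_iff.2 ⟨tendsto_const_nhds.prodMk_nhds (hy.comp hφ.tendsto_atTop),
        Eventually.of_forall hmemj⟩
    have hWy : Tendsto (fun j => W ((0 : ℝ), y (φ j))) atTop (𝓝 (W ((0 : ℝ), yStar))) :=
      (hWc _ (mk_mem_prod self_mem_Iic (mem_univ _))).tendsto.comp hyφ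
    have hyT : ∀ᶠ j in atTop, (((0 : ℝ), y (φ j)) : ℝ × EuclideanSpace ℝ (Fin 3)) ∈ T n :=
      hyφ.eventually_mem hn
    refine le_of_forall_pos_le_add fun ε hε => ?_
    have hu : ∀ᶠ j in atTop, ∀ z ∈ T n, dist (W z) (V (φ j) z) < ε / 2 :=
      Metric.tendstoUniformlyOn_iff.1 (hW n) (ε / 2) (half_pos hε)
    have hWy' : ∀ᶠ j in atTop, dist (W ((0 : ℝ), y (φ j))) (W ((0 : ℝ), yStar)) < ε / 2 :=
      Metric.tendsto_nhds.1 hWy (ε / 2) (half_pos hε)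
    obtain ⟨j, hj1, hj2, hj3⟩ := (hu.and (hWy'.and hyT)).exists
    have e0 : m ≤ ‖V (φ j) ((0 : ℝ), y (φ j))‖ := hmV (φ j)
    have e1 := hj1 _ hj3
    rw [dist_eq_norm] at e1 hj2
    have e2 := norm_le_norm_add_norm_sub (W ((0 : ℝ), y (φ j))) (V (φ j) ((0 : ℝ), y (φ j)))
    have e3 := norm_le_norm_add_norm_sub' (W ((0 : ℝ), y (φ j))) (W ((0 : ℝ), yStar))
    linarith
  /- Step 4: the limit `w(t, x) = W(t, x)` has all the required properties. -/
  refine ⟨fun t x => W (t, x), ⟨?_, ⟨1, fun t ht x => hWb (t, x) (le_of_lt ht)⟩, ?_, ?_⟩,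
    ?_, ?_, ?_⟩
  · -- measurability on the slab
    exact hWc'.aestronglyMeasurable (measurableSet_Iio.prod MeasurableSet.univ)
  · -- divergence-free slices for a.e. `t < 0`
    refine ae_isWeaklyDivFree_of_forall_spaceTimeTest hWc' (fun z hz => hWb z (le_of_lt hz.1))
      fun Θ hΘ => ?_
    have hK0 : tsupport (uncurry Θ) ⊆ Iio (0 : ℝ) ×ˢ (univ : Set (EuclideanSpace ℝ (Fin 3))) := by
      simpa only [coe_slab] using hΘ.tsupport_subset
    obtain ⟨N, hN⟩ := exists_nat_subset_parCyl hΘ.hasCompactSupport hK0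
    have hN0 : (0 : ℝ) ≤ (N : ℝ) + 1 := by positivity
    have hsub : parCyl 0 ((N : ℝ) + 1) ⊆ T N := parCyl_subset_closedTop ((N : ℝ) + 1)
    have hΘ' : IsSpaceTimeTestOn (⊤ : Opens (ℝ × EuclideanSpace ℝ (Fin 3))) Θ := hΘ.mono le_top
    have hlim := tendsto_setIntegral_inner_gradient ((hW N).mono hsub)
      ((hevφ N).mono fun j hj => hj.1.mono hsub) ((hevφ N).mono fun j hj z hz => hj.2.1 z (hsub hz))
      hΘ'
    have h0 : ∀ᶠ j in atTop, ∫ z in parCyl 0 ((N : ℝ) + 1), ⟪V (φ j) z, gradient (Θ z.1) z.2⟫ = 0 := by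
      filter_upwards [hφ.tendsto_atTop.eventually (hR.eventually_ge_atTop ((N : ℝ) + 1))] with j hj
      exact setIntegral_inner_gradient_eq_zero hN0 hj (hNS (φ j)) (hVU (φ j)) hΘ' hN
    have hL : ∫ z in parCyl 0 ((N : ℝ) + 1), ⟪W z, gradient (Θ z.1) z.2⟫ = 0 :=
      tendsto_nhds_unique (hlim.congr' h0) tendsto_const_nhds
    rw [← setIntegral_inner_gradient_eq_integral W hN]
    exact hL
  · -- the weak Navier–Stokes identity against divergence-free test fields
    intro ψ hψ hdiv
    have hK0 : tsupport (uncurry ψ) ⊆ Iio (0 : ℝ) ×ˢ (univ : Set (EuclideanSpace ℝ (Fin 3))) := by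
      simpa only [coe_slab] using hψ.tsupport_subset
    obtain ⟨N, hN⟩ := exists_nat_subset_parCyl hψ.hasCompactSupport hK0
    have hN0 : (0 : ℝ) ≤ (N : ℝ) + 1 := by positivity
    have hsub : parCyl 0 ((N : ℝ) + 1) ⊆ T N := parCyl_subset_closedTop ((N : ℝ) + 1)
    have hψ' : IsSpaceTimeTestOn (⊤ : Opens (ℝ × EuclideanSpace ℝ (Fin 3))) ψ := hψ.mono le_top
    have hlim := tendsto_setIntegral_nsIntegrand ((hW N).mono hsub)
      ((hevφ N).mono fun j hj => hj.1.mono hsub) ((hevφ N).mono fun j hj z hz => hj.2.1 z (hsub hz))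
      hψ'
    have h0 : ∀ᶠ j in atTop, ∫ z in parCyl 0 ((N : ℝ) + 1), (⟪V (φ j) z, timeDeriv ψ z.1 z.2⟫ +
        ⟪V (φ j) z, fderiv ℝ (ψ z.1) z.2 (V (φ j) z)⟫ + ⟪V (φ j) z, Δ (ψ z.1) z.2⟫) = 0 := by
      filter_upwards [hφ.tendsto_atTop.eventually (hR.eventually_ge_atTop ((N : ℝ) + 1))] with j hj
      exact setIntegral_nsIntegrand_eq_zero hN0 hj (hNS (φ j)) (hVU (φ j)) hψ' hN hdiv
    have hL : ∫ z in parCyl 0 ((N : ℝ) + 1), (⟪W z, timeDeriv ψ z.1 z.2⟫ +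
        ⟪W z, fderiv ℝ (ψ z.1) z.2 (W z)⟫ + ⟪W z, Δ (ψ z.1) z.2⟫) = 0 :=
      tendsto_nhds_unique (hlim.congr' h0) tendsto_const_nhds
    rw [setIntegral_nsIntegrand_eq_integral_Iio hWc' hψ' hN] at hL
    simpa only [convect_apply, one_mul] using hL
  · -- axial symmetry, a.e. form
    intro θ
    exact ae_rotZ_of_isAxisymmetric (u := fun t x => W (t, x))
      (fun t ht θ' x => hWrot θ' (t, x) ht.le) θ
  · -- the decay (p10), a.e. form
    exact ae_cylRadius_mul_norm_le_of_forall (u := fun t x => W (t, x))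
      fun t ht x => hWdec (t, x) ht.le
  · -- not a.e. zero: `|W| > m / 2` near `(0, y_*)` up to the top slice
    intro hzero
    have hcont0 : ContinuousWithinAt W (Iic 0 ×ˢ univ) ((0 : ℝ), yStar) :=
      hWc _ (mk_mem_prod self_mem_Iic (mem_univ _))
    obtain ⟨δ, hδ, hδW⟩ := Metric.continuousWithinAt_iff.1 hcont0 (m / 2) (half_pos hm)
    have hae : ∀ᵐ t ∂(volume.restrict (Ioo (-δ) (0 : ℝ))),
        (fun x => W (t, x)) =ᵐ[volume] (0 : EuclideanSpace ℝ (Fin 3) → EuclideanSpace ℝ (Fin 3)) ∧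
          t ∈ Ioo (-δ) 0 := by
      have h1 : ∀ᵐ t ∂(volume.restrict (Ioo (-δ) (0 : ℝ))),
          (fun x => W (t, x)) =ᵐ[volume] (0 : EuclideanSpace ℝ (Fin 3) → EuclideanSpace ℝ (Fin 3)) :=
        ae_restrict_of_ae_restrict_of_subset Ioo_subset_Iio_self hzero
      filter_upwards [h1, ae_restrict_mem measurableSet_Ioo] with t h h'
      exact ⟨h, h'⟩
    haveI : (ae (volume.restrict (Ioo (-δ) (0 : ℝ)))).NeBot := by
      rw [ae_neBot, Ne, Measure.restrict_eq_zero, Real.volume_Ioo]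
      exact (ENNReal.ofReal_pos.2 (by linarith)).ne'
    obtain ⟨t, ht0, ht⟩ := hae.exists
    have hnull : volume {x : EuclideanSpace ℝ (Fin 3) | ¬ W (t, x) = 0} = 0 := ae_iff.1 ht0
    have hball : ball yStar δ ⊆ {x : EuclideanSpace ℝ (Fin 3) | ¬ W (t, x) = 0} := by
      intro x hx h0
      have hdist : dist (((t, x)) : ℝ × EuclideanSpace ℝ (Fin 3)) ((0 : ℝ), yStar) < δ := by
        rw [Prod.dist_eq]
        refine max_lt ?_ (mem_ball.1 hx)
        rw [Real.dist_eq, sub_zero]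
        exact abs_lt.2 ⟨ht.1, by linarith [ht.2]⟩
      have hmem : ((t, x) : ℝ × EuclideanSpace ℝ (Fin 3)) ∈
          Iic (0 : ℝ) ×ˢ (univ : Set (EuclideanSpace ℝ (Fin 3))) :=
        mk_mem_prod (mem_Iic.2 ht.2.le) (mem_univ _)
      have key := hδW hmem hdist
      rw [h0, dist_comm, dist_zero_right] at key
      linarith
    exact (measure_ball_pos volume yStar hδ).ne' (measure_mono_null hball hnull)

/-- **The blow-up alternative under Type I, conditional on the two regularity inputs of §4**:
`InteriorContinuity → LocalHolderBound → BlowupAlternativeTypeI` (the sibling reduction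
`blowupAlternativeTypeI_of_facts` fed with `blowupCompactness_of_localHolderBound`).
[cite: SereginSverak2009, §4 (proof of Thm. 3.1, arXiv p. 11)] -/
theorem blowupAlternativeTypeI_of_localHolderBound (hIC : InteriorContinuity)
    (hLHB : LocalHolderBound) : BlowupAlternativeTypeI :=
  blowupAlternativeTypeI_of_facts hIC (blowupCompactness_of_localHolderBound hLHB)

/-- **Seregin–Šverák 2009, Theorem 3.1, conditional on the catalogued analytic inputs**, with
the compactness of the blow-up sequence replaced by the local Hölder bound behind it: from
Lemma 3.5 (`ScaledEnergyBound`), Prop. 3.7 (`AxisDecayBound`), interior continuity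
(`InteriorContinuity`), the uniform local Hölder bound (`LocalHolderBound`: [LSU], [S8] and the
parabolic embedding) and KNSS 2009, Thm. 5.3 (`KNSS2009_liouville_bound_C_over_r`), every
axially symmetric distributional solution in `Q` with `u ∈ L³(Q)`, `p ∈ L^{3/2}(Q)` and the
Type I bound is regular at the origin. [cite: SereginSverak2009, Thm. 3.1 and §4] -/
theorem isRegularAtOrigin_of_typeI_of_localHolderBound (h35 : ScaledEnergyBound)
    (h37 : AxisDecayBound) (hIC : InteriorContinuity) (hLHB : LocalHolderBound)
    (h53 : KNSS2009_liouville_bound_C_over_r)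
    {u : ℝ → EuclideanSpace ℝ (Fin 3) → EuclideanSpace ℝ (Fin 3)}
    {p : ℝ → EuclideanSpace ℝ (Fin 3) → ℝ}
    (hsol : IsAxisymmetricLocalSolution u p) (hI : IsTypeIOnCyl u) : IsRegularAtOrigin u :=
  isRegularAtOrigin_of_typeI_of_facts h35 h37 hIC (blowupCompactness_of_localHolderBound hLHB)
    h53 hsol hI

end SereginSverak2009

end Literature.Analysis.FluidPDE
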